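import Literature.NumberTheory.LFunctions.ExplicitFormulaPsiCharConst
import Literature.NumberTheory.LFunctions.ExplicitFormulaPsiCharHeights
import Literature.NumberTheory.LFunctions.ExplicitFormulaPsiCharPerron
import HarnessLib

/-!
# The truncated explicit formula for `ψ(x, χ)` (Montgomery–Vaughan Thm. 12.10): proof

Topic `Literature/NumberTheory/LFunctions`. THEOREMS (everything proved). DISCHARGE of the named
fact `Literature.NumberTheory.LFunctions.truncatedExplicitFormula_psiChar` (`ExplicitFormulaPsiChar.lean`),
Montgomery–Vaughan, *Multiplicative Number Theory I*, Thm. 12.10: for `c > 1` there is `K = K(c)`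
such that for every `q > 1`, every primitive `χ` mod `q`, every `x ≥ c` and `T ≥ 2`,

  **`|ψ₀(x, χ) − (−∑_{|γ| ≤ T} x^ρ/ρ − ½ log(x − 1) − (χ(−1)/2) log(x + 1) + C(χ))| ≤
    K ((log x) min(1, x/(T⟨x⟩)) + (x/T) log²(qxT))`**

(`Literature.NumberTheory.LFunctions.truncatedExplicitFormula_psiChar_holds`). The proof is MV's
(p. 404, "we apply Perron's formula as in the proof of Theorem 12.5 … the only differences are the
pole at `s = 0` and the dependence on `q`"), assembled from

* Perron's formula with remainder for `ψ₀(x, χ)` at `b = 1 + 1/log x`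
  (`ExplicitPsiChar.perron_chebyshevPsiChar₀`, `ExplicitFormulaPsiCharPerron.lean`);
* a good height `T₁ ∈ [T, T + 1]` at distance `η ≫ 1/ℒ` from every ordinate `±γ`
  (`ExplicitPsiChar.exists_goodHeight`, MV Lemma 12.7);
* the residue theorem on `[−2K−1/2, b] × [−T₁, T₁]` with `K → ∞`
  (`ExplicitPsiChar.rightEdge_identity`, `ExplicitFormulaPsiCharContour.lean`), whose residue at `0`
  plus the trivial-zero series is `−½ log(x−1) − (χ(−1)/2) log(x+1) + C(χ)`
  (`ExplicitPsiChar.residue_data`, `ExplicitFormulaPsiCharConst.lean`, MV (12.9));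
* the horizontal integrals `∫_{−∞}^{b} (−L'/L)(σ ± iT₁, χ) x^{σ±iT₁}/(σ±iT₁) dσ ≪_c (x/T) ℒ²`
  (`horizontal_integral_bound`: `|L'/L| ≪ ℒ²` on `[−1/2, 3/2]` at the good height, `≪ 1` on
  `σ ≥ 3/2`, `≪ log q + log|t| + |σ|` on `σ ≤ −1/2`, MV Lemmas 12.6–12.9,
  `ExplicitFormulaPsiCharLogDeriv.lean`);
* the zeros with `T < |γ| ≤ T₁`, `≪ ℒ` in number, each contributing `≤ x/T`
  (`ExplicitPsiChar.sum_order_sdiff_le`, `ExplicitPsiChar.norm_charZeroSum_sub_le`, MV Thm. 10.17).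

Here `ℒ ≤ 3 log(qxT)`; the constant depends on `c` through `1/log c` only.

## References

* H. L. Montgomery, R. C. Vaughan, *Multiplicative Number Theory I. Classical Theory*, CUP 2007,
  §12.1, Theorem 12.10 ((12.6)–(12.9)), Lemmas 12.6–12.9, Theorem 10.17. [MontgomeryVaughan2007]
-/

noncomputable section

open Complex Filter Set MeasureTheory Topology intervalIntegral
open scoped Real Interval

namespace Literature.NumberTheory.LFunctions

namespace ExplicitPsiChar

open DirichletCharacter Literature.NumberTheory.LFunctions.SiegelZero ExplicitPsi PsiOneExplicit

variable {q : ℕ} [NeZero q] {χ : DirichletCharacter ℂ q}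

/-! ### The integrand on the horizontal half-lines `(−∞, b] ± iT₁` -/

/-- At a height `t` at distance `≥ η > 0` from every ordinate, `L(σ + it, χ) ≠ 0` for every `σ`
(primitive `χ` mod `q > 1`). [folklore] -/
theorem LFunction_ne_zero_of_goodHeight (hprim : χ.IsPrimitive) (hq : 1 < q) {t η : ℝ} (ht : t ≠ 0)
    (hη : 0 < η) (hZ : ∀ ρ : ℂ, χ.LFunction ρ = 0 → 0 < ρ.re → ρ.re < 1 → η ≤ |ρ.im - t|) (σ : ℝ) :
    χ.LFunction ((σ : ℂ) + t * I) ≠ 0 := by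
  intro h0
  have hχ : χ ≠ 1 := ne_one_of_isPrimitive hprim hq
  obtain ⟨h1, h2⟩ := re_mem_Ioo_of_LFunction_eq_zero_of_im_ne_zero hprim hχ h0 (by simpa using ht)
  have := hZ _ h0 h1 h2
  simp at this
  linarith

/-- **Pointwise bound on the half-lines.** With the constants `A` (left half-plane), `Ch` (strip at
a good height) of `ExplicitFormulaPsiCharLogDeriv.lean` and `M₀ = ∑ Λ(n) n^{-3/2}`: if `|t| ≥ 2`,
`0 < η ≤ 1`, every non-trivial zero is `η`-away from the ordinate `t`, and
`Λ₀ ≥ A + ℒ + Ch ℒ/η + M₀` (`ℒ = log q + log(|t| + 4)`), then for every `σ`,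
`‖(−L'/L)(σ+it, χ) x^{σ+it}/(σ+it)‖ ≤ (Λ₀ + 5 max(−σ, 0)) x^σ/|t|`.
[cite: MontgomeryVaughan2007, Thm. 12.10 (proof)] -/
theorem norm_integrand_horizontal_le {A Ch : ℝ}
    (hA : ∀ (q : ℕ) [NeZero q] (χ : DirichletCharacter ℂ q), χ.IsPrimitive → 1 < q →
      ∀ σ t : ℝ, σ ≤ -(1 / 2) → 2 ≤ |t| →
        χ.LFunction (σ + t * I) ≠ 0 ∧
          ‖logDeriv χ.LFunction (σ + t * I)‖ ≤ A + Real.log q + Real.log (|t| + 4) + 5 * (-σ))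
    (hCh : ∀ (q : ℕ) [NeZero q] (χ : DirichletCharacter ℂ q), χ.IsPrimitive → 1 < q →
      ∀ t η : ℝ, 2 ≤ |t| → 0 < η → η ≤ 1 →
        (∀ ρ : ℂ, χ.LFunction ρ = 0 → 0 < ρ.re → ρ.re < 1 → η ≤ |ρ.im - t|) →
        ∀ σ : ℝ, σ ∈ Icc (-(1 / 2) : ℝ) (3 / 2) →
          χ.LFunction (σ + t * I) ≠ 0 ∧
            ‖logDeriv χ.LFunction (σ + t * I)‖ ≤ Ch * (Real.log q + Real.log (|t| + 4)) / η)
    (hprim : χ.IsPrimitive) (hq : 1 < q)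
    {x t η Λ₀ : ℝ} (hx : 0 < x) (ht : 2 ≤ |t|) (hη : 0 < η) (hη1 : η ≤ 1)
    (hZ : ∀ ρ : ℂ, χ.LFunction ρ = 0 → 0 < ρ.re → ρ.re < 1 → η ≤ |ρ.im - t|)
    (hΛ₀ : A + (Real.log q + Real.log (|t| + 4)) + Ch * (Real.log q + Real.log (|t| + 4)) / η +
      ∑' n : ℕ, ‖LSeries.term (fun n ↦ (ArithmeticFunction.vonMangoldt n : ℂ)) (3 / 2 : ℂ) n‖ ≤ Λ₀)
    (hCh0 : 0 ≤ Ch) (hA0 : 0 ≤ A) (σ : ℝ) :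
    ‖(fun s : ℂ ↦ (-logDeriv χ.LFunction s) * ((x : ℂ) ^ s / s)) ((σ : ℂ) + t * I)‖ ≤
      (Λ₀ + 5 * max (-σ) 0) * (x ^ σ / |t|) := by
  have ht0 : t ≠ 0 := fun h ↦ by rw [h, abs_zero] at ht; linarith
  set M₀ : ℝ := ∑' n : ℕ, ‖LSeries.term (fun n ↦ (ArithmeticFunction.vonMangoldt n : ℂ)) (3 / 2 : ℂ) n‖
    with hM₀
  have hM₀0 : 0 ≤ M₀ := tsum_nonneg fun _ ↦ norm_nonneg _
  have hq1 : (1 : ℝ) ≤ q := by exact_mod_cast le_of_lt hq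
  have hlogq : 0 ≤ Real.log q := Real.log_nonneg hq1
  have hlog4 : 0 ≤ Real.log (|t| + 4) := Real.log_nonneg (by linarith [abs_nonneg t])
  set ℒ : ℝ := Real.log q + Real.log (|t| + 4) with hℒ
  have hℒ0 : 0 ≤ ℒ := by positivity
  have hmax : 0 ≤ max (-σ) 0 := le_max_right _ _
  have hCη : 0 ≤ Ch * ℒ / η := by positivity
  have hΛ₀0 : 0 ≤ Λ₀ := le_trans (by positivity) hΛ₀
  have hk := norm_cpow_div_le_horizontal hx σ ht0
  show ‖(-logDeriv χ.LFunction ((σ : ℂ) + t * I)) *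
      ((x : ℂ) ^ ((σ : ℂ) + t * I) / ((σ : ℂ) + t * I))‖ ≤ _
  rw [norm_mul, norm_neg]
  refine mul_le_mul ?_ hk (norm_nonneg _) (by positivity)
  rcases le_or_gt σ (-(1 / 2)) with h1 | h1
  · have h := (hA q χ hprim hq σ t h1 ht).2
    have : 5 * (-σ) ≤ 5 * max (-σ) 0 := by linarith [le_max_left (-σ) 0]
    linarith
  rcases le_or_gt σ (3 / 2) with h2 | h2
  · have h := (hCh q χ hprim hq t η ht hη hη1 hZ σ ⟨h1.le, h2⟩).2
    linarith
  · have hs : 3 / 2 ≤ ((σ : ℂ) + t * I).re := by simp; linarith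
    have h := norm_logDeriv_LFunction_le_of_re_ge χ hs
    linarith

/-- Continuity of `σ ↦ (−L'/L)(σ+it, χ) x^{σ+it}/(σ+it)` at a good height `t`. [folklore] -/
theorem continuous_integrand_horizontal (hprim : χ.IsPrimitive) (hq : 1 < q) {x t η : ℝ}
    (hx : 0 < x) (ht : t ≠ 0) (hη : 0 < η)
    (hZ : ∀ ρ : ℂ, χ.LFunction ρ = 0 → 0 < ρ.re → ρ.re < 1 → η ≤ |ρ.im - t|) :
    Continuous fun σ : ℝ ↦
      (fun s : ℂ ↦ (-logDeriv χ.LFunction s) * ((x : ℂ) ^ s / s)) ((σ : ℂ) + t * I) := by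
  have hχ : χ ≠ 1 := ne_one_of_isPrimitive hprim hq
  refine continuous_iff_continuousAt.2 fun σ ↦ ?_
  have h := continuousAt_integrand hχ hx (LFunction_ne_zero_of_goodHeight hprim hq ht hη hZ σ)
    (fun h ↦ ht (by simpa using congrArg Complex.im h))
  exact h.comp (f := fun σ : ℝ ↦ (σ : ℂ) + t * I) (Continuous.continuousAt (by fun_prop))

/-- **The horizontal half-lines.** Under the hypotheses of `norm_integrand_horizontal_le`, for
`x > 1` and `b = 1 + 1/log x`, the integrand is integrable on `(−∞, b] + it` and
`‖∫_{−∞}^{b} (−L'/L)(σ+it, χ) x^{σ+it}/(σ+it) dσ‖ ≤ e·x·(Λ₀/log x + 20/(e log² x))/|t|`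
(majorant `(Λ₀ x^σ + (10/(e log x)) x^{σ/2})/|t|`, `∫_{−∞}^{b} x^σ dσ = e x/log x`).
[cite: MontgomeryVaughan2007, Thm. 12.10 (proof)] -/
theorem horizontal_integral_bound {A Ch : ℝ}
    (hA : ∀ (q : ℕ) [NeZero q] (χ : DirichletCharacter ℂ q), χ.IsPrimitive → 1 < q →
      ∀ σ t : ℝ, σ ≤ -(1 / 2) → 2 ≤ |t| →
        χ.LFunction (σ + t * I) ≠ 0 ∧
          ‖logDeriv χ.LFunction (σ + t * I)‖ ≤ A + Real.log q + Real.log (|t| + 4) + 5 * (-σ))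
    (hCh : ∀ (q : ℕ) [NeZero q] (χ : DirichletCharacter ℂ q), χ.IsPrimitive → 1 < q →
      ∀ t η : ℝ, 2 ≤ |t| → 0 < η → η ≤ 1 →
        (∀ ρ : ℂ, χ.LFunction ρ = 0 → 0 < ρ.re → ρ.re < 1 → η ≤ |ρ.im - t|) →
        ∀ σ : ℝ, σ ∈ Icc (-(1 / 2) : ℝ) (3 / 2) →
          χ.LFunction (σ + t * I) ≠ 0 ∧
            ‖logDeriv χ.LFunction (σ + t * I)‖ ≤ Ch * (Real.log q + Real.log (|t| + 4)) / η)
    (hprim : χ.IsPrimitive) (hq : 1 < q)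
    {x t η Λ₀ b : ℝ} (hx : 1 < x) (hb : b = 1 + 1 / Real.log x) (ht : 2 ≤ |t|) (hη : 0 < η)
    (hη1 : η ≤ 1) (hZ : ∀ ρ : ℂ, χ.LFunction ρ = 0 → 0 < ρ.re → ρ.re < 1 → η ≤ |ρ.im - t|)
    (hΛ₀ : A + (Real.log q + Real.log (|t| + 4)) + Ch * (Real.log q + Real.log (|t| + 4)) / η +
      ∑' n : ℕ, ‖LSeries.term (fun n ↦ (ArithmeticFunction.vonMangoldt n : ℂ)) (3 / 2 : ℂ) n‖ ≤ Λ₀)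
    (hCh0 : 0 ≤ Ch) (hA0 : 0 ≤ A) :
    IntegrableOn (fun σ : ℝ ↦
      (fun s : ℂ ↦ (-logDeriv χ.LFunction s) * ((x : ℂ) ^ s / s)) ((σ : ℂ) + t * I)) (Iic b) ∧
    ‖∫ σ in Iic b,
        (fun s : ℂ ↦ (-logDeriv χ.LFunction s) * ((x : ℂ) ^ s / s)) ((σ : ℂ) + t * I)‖ ≤
      Real.exp 1 * x * (Λ₀ / Real.log x + 20 / (Real.exp 1 * Real.log x ^ 2)) / |t| := by
  have hx0 : 0 < x := by linarith
  have ht0 : t ≠ 0 := fun h ↦ by rw [h, abs_zero] at ht; linarith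
  have htpos : 0 < |t| := by linarith
  have hL0 : 0 < Real.log x := Real.log_pos hx
  have hM₀0 : 0 ≤ ∑' n : ℕ, ‖LSeries.term (fun n ↦ (ArithmeticFunction.vonMangoldt n : ℂ)) (3 / 2 : ℂ) n‖ :=
    tsum_nonneg fun _ ↦ norm_nonneg _
  have hq1 : (1 : ℝ) ≤ q := by exact_mod_cast le_of_lt hq
  have hlogq : 0 ≤ Real.log q := Real.log_nonneg hq1
  have hlog4 : 0 ≤ Real.log (|t| + 4) := Real.log_nonneg (by linarith)
  have hCη : 0 ≤ Ch * (Real.log q + Real.log (|t| + 4)) / η := by positivity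
  have hΛ₀0 : 0 ≤ Λ₀ := le_trans (by positivity) hΛ₀
  set G : ℝ → ℂ := fun σ ↦
    (fun s : ℂ ↦ (-logDeriv χ.LFunction s) * ((x : ℂ) ^ s / s)) ((σ : ℂ) + t * I) with hG
  set m : ℝ → ℝ := fun σ ↦ (Λ₀ * Real.exp (Real.log x * σ) +
    10 / (Real.exp 1 * Real.log x) * Real.exp (Real.log x / 2 * σ)) / |t| with hm
  have hGm : ∀ σ : ℝ, ‖G σ‖ ≤ m σ := by
    intro σ
    have h := norm_integrand_horizontal_le hA hCh hprim hq hx0 ht hη hη1 hZ hΛ₀ hCh0 hA0 σ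
    refine h.trans ?_
    have hw := max_neg_mul_exp_le (σ := σ) hL0
    rw [hm]
    simp only
    rw [Real.rpow_def_of_pos hx0, mul_div_assoc']
    refine div_le_div_of_nonneg_right ?_ htpos.le
    nlinarith [Real.exp_pos (Real.log x * σ)]
  have hGcont : Continuous G := continuous_integrand_horizontal hprim hq hx0 ht0 hη hZ
  have hm_int : Integrable m (volume.restrict (Iic b)) := by
    have h1 : IntegrableOn (fun σ : ℝ ↦ Real.exp (Real.log x * σ)) (Iic b) :=
      integrableOn_exp_mul_Iic hL0 b
    have h2 : IntegrableOn (fun σ : ℝ ↦ Real.exp (Real.log x / 2 * σ)) (Iic b) :=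
      integrableOn_exp_mul_Iic (half_pos hL0) b
    exact ((h1.const_mul Λ₀).add (h2.const_mul _)).div_const |t|
  have hG_int : IntegrableOn G (Iic b) :=
    Integrable.mono' hm_int hGcont.aestronglyMeasurable (ae_of_all _ hGm)
  refine ⟨hG_int, ?_⟩
  have hint_m : ∫ σ in Iic b, m σ = (Λ₀ * (Real.exp (Real.log x * b) / Real.log x) +
      10 / (Real.exp 1 * Real.log x) * (Real.exp (Real.log x / 2 * b) / (Real.log x / 2))) / |t| := by
    have h1 : IntegrableOn (fun σ : ℝ ↦ Real.exp (Real.log x * σ)) (Iic b) :=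
      integrableOn_exp_mul_Iic hL0 b
    have h2 : IntegrableOn (fun σ : ℝ ↦ Real.exp (Real.log x / 2 * σ)) (Iic b) :=
      integrableOn_exp_mul_Iic (half_pos hL0) b
    rw [hm]
    simp only
    rw [MeasureTheory.integral_div, MeasureTheory.integral_add (h1.const_mul Λ₀) (h2.const_mul _),
      MeasureTheory.integral_const_mul, MeasureTheory.integral_const_mul,
      integral_exp_mul_Iic hL0, integral_exp_mul_Iic (half_pos hL0)]
  have hexb : Real.exp (Real.log x * b) = Real.exp 1 * x := by
    rw [hb, mul_add, mul_one, mul_one_div_cancel hL0.ne', Real.exp_add, Real.exp_log hx0, mul_comm]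
  have hexb2 : Real.exp (Real.log x / 2 * b) ≤ Real.exp 1 * x := by
    rw [← hexb]
    refine Real.exp_le_exp.2 ?_
    have hb0 : 0 < b := by rw [hb]; positivity
    nlinarith
  calc ‖∫ σ in Iic b, G σ‖ ≤ ∫ σ in Iic b, m σ :=
        norm_integral_le_of_norm_le hm_int (ae_of_all _ hGm)
    _ = (Λ₀ * (Real.exp (Real.log x * b) / Real.log x) +
          10 / (Real.exp 1 * Real.log x) * (Real.exp (Real.log x / 2 * b) / (Real.log x / 2))) / |t| :=
        hint_m
    _ ≤ (Λ₀ * (Real.exp 1 * x / Real.log x) +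
          10 / (Real.exp 1 * Real.log x) * (Real.exp 1 * x / (Real.log x / 2))) / |t| := by
        rw [hexb]
        gcongr
    _ = Real.exp 1 * x * (Λ₀ / Real.log x + 20 / (Real.exp 1 * Real.log x ^ 2)) / |t| := by
        field_simp
        ring

end ExplicitPsiChar

/-! ### Assembly: Montgomery–Vaughan Thm. 12.10 -/

set_option maxHeartbeats 3200000 in
open ExplicitPsiChar ExplicitPsi PsiOneExplicit in
/-- **MV Thm. 12.10, PROVED** (the truncated explicit formula for `ψ(x, χ)`, Montgomery–Vaughan,
*Multiplicative Number Theory I*, Thm. 12.10, (12.6)–(12.8)): for every `c > 1` there is `K` such that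
for all `q > 1`, all primitive `χ` mod `q`, all `x ≥ c` and `T ≥ 2`,
`‖ψ₀(x, χ) − (−∑_{|γ| ≤ T} m(ρ)x^ρ/ρ − ½ log(x−1) − (χ(−1)/2) log(x+1) + C(χ))‖ ≤
  K ((log x) min(1, x/(T⟨x⟩)) + (x/T) log²(qxT))`.
Proof as in MV p. 404 (and pp. 400–401 for Thm. 12.5): Perron's formula for `ψ₀(x, χ)` with its
remainder (`ExplicitPsiChar.perron_chebyshevPsiChar₀`), a good height `T₁ ∈ [T, T+1]`
(`ExplicitPsiChar.exists_goodHeight`), the residue theorem on `[−2K−1/2, 1+1/log x] × [−T₁, T₁]`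
with `K → ∞` (`ExplicitPsiChar.rightEdge_identity`) whose residue at `0` and trivial zeros give
`−½ log(x−1) − (χ(−1)/2) log(x+1) + C(χ)` (`ExplicitPsiChar.residue_data`, MV (12.9)), the
horizontal integrals `≪_c (x/T) ℒ²` (`ExplicitPsiChar.horizontal_integral_bound`), and the zeros with
`T < |γ| ≤ T₁`, `≪ ℒ` in number, each contributing `≤ x/T`. This discharges the named fact
`truncatedExplicitFormula_psiChar`. [cite: MontgomeryVaughan2007, Theorem 12.10] -/
theorem truncatedExplicitFormula_psiChar_holds : truncatedExplicitFormula_psiChar := by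
  intro c hc
  -- constants
  obtain ⟨C₁, hC₁0, hPerron⟩ := ExplicitPsiChar.perron_chebyshevPsiChar₀ hc
  obtain ⟨A, hA0, hA⟩ := ExplicitPsiChar.exists_norm_logDeriv_LFunction_le_left
  obtain ⟨Ch, hCh0, hCh⟩ := ExplicitPsiChar.exists_norm_logDeriv_LFunction_le_strip
  obtain ⟨c₀, hc₀0, hgoodH⟩ := ExplicitPsiChar.exists_goodHeight
  obtain ⟨Cw, hCw0, hCw⟩ := ExplicitPsiChar.exists_sum_window_le
  set M₀ : ℝ := ∑' n : ℕ, ‖LSeries.term (fun n ↦ (ArithmeticFunction.vonMangoldt n : ℂ)) (3 / 2 : ℂ) n‖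
    with hM₀
  have hM₀0 : 0 ≤ M₀ := tsum_nonneg fun _ ↦ norm_nonneg _
  set lam : ℝ := Real.log c with hlam
  have hlam0 : 0 < lam := Real.log_pos hc
  set A₀ : ℝ := A + 1 + M₀ + 2 * Ch + Ch / c₀ with hA₀
  have hA₀0 : 0 ≤ A₀ := by positivity
  set A₁ : ℝ := Real.exp 1 * (A₀ / lam + 20 / (Real.exp 1 * lam ^ 2)) with hA₁
  have hA₁0 : 0 ≤ A₁ := by positivity
  refine ⟨C₁ + 27 * A₁ + 12 * Cw, fun q _ hq χ hprim x hx T hT ↦ ?_⟩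
  -- basics
  have hχ : χ ≠ 1 := ExplicitPsiChar.ne_one_of_isPrimitive hprim hq
  have hx1 : 1 < x := hc.trans_le hx
  have hx0 : 0 < x := by linarith
  have hL0 : 0 < Real.log x := Real.log_pos hx1
  have hLlam : lam ≤ Real.log x := Real.log_le_log (by linarith) hx
  set b : ℝ := 1 + 1 / Real.log x with hb
  have hb1 : 1 < b := by rw [hb]; simp [hL0]
  have hT0 : 0 < T := by linarith
  have hq2 : (2 : ℝ) ≤ q := by exact_mod_cast hq
  have hlogq : Real.log 2 ≤ Real.log q := Real.log_le_log two_pos hq2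
  have hlog2 : (1 / 2 : ℝ) < Real.log 2 := by have := Real.log_two_gt_d9; linarith
  have hlogq0 : 0 < Real.log q := by linarith
  -- a good height `T₁ ∈ [T, T+1]` and the distance `η`
  obtain ⟨T₁, ⟨hT₁, hT₁'⟩, hsep⟩ := hgoodH q χ hprim hq T hT0.le
  have hT₁2 : 2 ≤ T₁ := hT.trans hT₁
  have hT₁0 : 0 < T₁ := by linarith
  set ℒ : ℝ := Real.log q + Real.log (|T₁| + 4) with hℒ
  have habsT : |T₁| = T₁ := abs_of_pos hT₁0
  have habsT' : |(-T₁)| = T₁ := by rw [abs_neg, habsT]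
  have hℒ1 : 1 ≤ ℒ := DirichletZFR.one_le_ell q T₁
  have hℒ0 : 0 < ℒ := by linarith
  set η : ℝ := min (1 / 2) (c₀ / ℒ) with hη
  have hη0 : 0 < η := lt_min (by norm_num) (div_pos hc₀0 hℒ0)
  have hη1 : η ≤ 1 := (min_le_left _ _).trans (by norm_num)
  have hηinv : 1 / η ≤ 2 + ℒ / c₀ := by
    rw [hη]
    rcases min_cases (1 / 2 : ℝ) (c₀ / ℒ) with ⟨h, -⟩ | ⟨h, -⟩
    · rw [h, show (1 : ℝ) / (1 / 2) = 2 by norm_num]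
      have : 0 ≤ ℒ / c₀ := by positivity
      linarith
    · rw [h, one_div_div]
      linarith
  have hZ : ∀ ρ : ℂ, χ.LFunction ρ = 0 → 0 < ρ.re → ρ.re < 1 → η ≤ |ρ.im - T₁| ∧ η ≤ |ρ.im + T₁| := by
    intro ρ h0 h1 h2
    have h := hsep ρ h0 h1 h2
    exact dist_of_abs_sub_le hT₁0.le ((min_le_right _ _).trans h)
  have hgood : ∀ ρ : ℂ, χ.LFunction ρ = 0 → 0 < ρ.re → ρ.re < 1 → ρ.im ≠ T₁ ∧ ρ.im ≠ -T₁ := by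
    intro ρ h0 h1 h2
    obtain ⟨ha, hb'⟩ := hZ ρ h0 h1 h2
    refine ⟨fun h ↦ ?_, fun h ↦ ?_⟩
    · rw [h, sub_self, abs_zero] at ha; linarith
    · rw [h, neg_add_cancel, abs_zero] at hb'; linarith
  have hZtop : ∀ ρ : ℂ, χ.LFunction ρ = 0 → 0 < ρ.re → ρ.re < 1 → η ≤ |ρ.im - T₁| :=
    fun ρ h0 h1 h2 ↦ (hZ ρ h0 h1 h2).1
  have hZbot : ∀ ρ : ℂ, χ.LFunction ρ = 0 → 0 < ρ.re → ρ.re < 1 → η ≤ |ρ.im - (-T₁)| :=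
    fun ρ h0 h1 h2 ↦ by rw [sub_neg_eq_add]; exact (hZ ρ h0 h1 h2).2
  -- `Λ₀` and its size
  set Λ₀ : ℝ := A + ℒ + Ch * ℒ * (2 + ℒ / c₀) + M₀ with hΛ₀def
  have hΛ₀ : ∀ t : ℝ, |t| = T₁ →
      A + (Real.log q + Real.log (|t| + 4)) + Ch * (Real.log q + Real.log (|t| + 4)) / η + M₀ ≤ Λ₀ := by
    intro t ht
    rw [ht, ← habsT, ← hℒ]
    have h1 : Ch * ℒ / η ≤ Ch * ℒ * (2 + ℒ / c₀) := by
      rw [div_eq_mul_one_div]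
      exact mul_le_mul_of_nonneg_left hηinv (by positivity)
    linarith
  have hΛ₀A : Λ₀ ≤ A₀ * ℒ ^ 2 := by
    rw [hΛ₀def, hA₀]
    have hℒ2 : ℒ ≤ ℒ ^ 2 := by nlinarith
    have h1 : (1 : ℝ) ≤ ℒ ^ 2 := by nlinarith
    have h2 : Ch * ℒ * (2 + ℒ / c₀) = 2 * Ch * ℒ + Ch / c₀ * ℒ ^ 2 := by ring
    rw [h2]
    have p1 : 0 ≤ A * (ℒ ^ 2 - 1) := mul_nonneg hA0.le (by linarith)
    have p2 : 0 ≤ M₀ * (ℒ ^ 2 - 1) := mul_nonneg hM₀0 (by linarith)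
    have p3 : 0 ≤ Ch * (ℒ ^ 2 - ℒ) := mul_nonneg hCh0.le (by linarith)
    have p4 : 0 ≤ Ch / c₀ := by positivity
    nlinarith [mul_comm (Ch / c₀) (ℒ ^ 2)]
  -- the two horizontal half-lines
  obtain ⟨hint_top, hHtop⟩ := horizontal_integral_bound hA hCh hprim hq hx1 hb (t := T₁)
    (by rw [habsT]; exact hT₁2) hη0 hη1 hZtop (hΛ₀ T₁ habsT) hCh0.le hA0.le
  obtain ⟨hint_bot, hHbot⟩ := horizontal_integral_bound hA hCh hprim hq hx1 hb (t := -T₁)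
    (by rw [habsT']; exact hT₁2) hη0 hη1 hZbot (hΛ₀ (-T₁) habsT') hCh0.le hA0.le
  rw [habsT] at hHtop
  rw [habsT'] at hHbot
  -- the residue data and the contour
  obtain ⟨m₀, h, a, hhd, hh0, hLh, ha, hGa, hres⟩ := ExplicitPsiChar.residue_data hprim hq
  obtain ⟨V, hV, hconst⟩ := hres x hx1
  have hB := ExplicitPsiChar.rightEdge_identity hprim hq hx1 hb1 (by linarith : (1 : ℝ) ≤ T₁) hgood hhd hh0
    hLh ha hGa hV hint_top hint_bot
  -- Perron
  have hP := hPerron q χ x hx T₁ (by linarith) b hb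
  -- the zeros between `T` and `T₁`
  have hS := ExplicitPsiChar.norm_charZeroSum_sub_le hχ hx1.le hT0 hT₁
  have hD := ExplicitPsiChar.sum_order_sdiff_le hCw hprim hq hT0.le hT₁'
  -- names
  set G : ℂ → ℂ := fun s ↦ (-logDeriv χ.LFunction s) * ((x : ℂ) ^ s / s) with hG
  set W : ℂ := ∫ t in (-T₁)..T₁, G ((b : ℂ) + t * I) with hW
  set Hb : ℂ := ∫ σ in Iic b, G ((σ : ℂ) + (-T₁ : ℝ) * I) with hHb
  set Ht : ℂ := ∫ σ in Iic b, G ((σ : ℂ) + T₁ * I) with hHt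
  set S₁ : ℂ := ∑ ρ ∈ (lfunctionZeroBox_finite (ExplicitPsiChar.ne_one_of_isPrimitive hprim hq) T₁).toFinset,
    (DirichletDisc.zeroOrder χ ρ : ℂ) * ((x : ℂ) ^ ρ / ρ) with hS₁
  set S : ℂ := ∑ ρ ∈ (lfunctionZeroBox_finite (ExplicitPsiChar.ne_one_of_isPrimitive hprim hq) T).toFinset,
    (DirichletDisc.zeroOrder χ ρ : ℂ) * ((x : ℂ) ^ ρ / ρ) with hSdef
  set Rc : ℂ := -(1 / 2 * ((Real.log (x - 1) : ℝ) : ℂ)) - χ (-1) / 2 * ((Real.log (x + 1) : ℝ) : ℂ) +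
    explicitFormulaConst χ with hRc
  set R₁ : ℂ := -S₁ + Rc with hR₁
  set D : ℝ := ∑ ρ ∈ (lfunctionZeroBox_finite (ExplicitPsiChar.ne_one_of_isPrimitive hprim hq) T₁).toFinset \
      (lfunctionZeroBox_finite (ExplicitPsiChar.ne_one_of_isPrimitive hprim hq) T).toFinset,
    (DirichletDisc.zeroOrder χ ρ : ℝ) with hDdef
  have hnorm2π : ‖(2 * π : ℂ)‖ = 2 * π := by
    rw [show (2 * π : ℂ) = ((2 * π : ℝ) : ℂ) by norm_cast, Complex.norm_real, Real.norm_eq_abs,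
      abs_of_pos (by positivity)]
  have hπC : (2 * π : ℂ) ≠ 0 := by
    intro h0; rw [h0, norm_zero] at hnorm2π; linarith [Real.pi_pos]
  -- `W = 2π R₁ + i (Hb − Ht)`
  have hVeq : W = 2 * π * R₁ + I * (Hb - Ht) := by
    have hI : I * I = -1 := I_mul_I
    have hB' : I * W = 2 * π * I * R₁ - Hb + Ht := by
      rw [hR₁, ← hconst]
      linear_combination hB
    linear_combination (-I) * hB' + (W - 2 * π * R₁) * hI
  -- Perron in our names
  have hP' : ‖W - 2 * π * chebyshevPsiChar₀ χ x‖ ≤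
      C₁ * (Real.log x * min 1 (x / (T₁ * primePowDist x)) + x / T₁ * Real.log x ^ 2) := by
    rw [hW]; exact hP
  -- the target, decomposed
  have hzs : charZeroSumTrunc χ x T = S := charZeroSumTrunc_eq hχ x T
  have hzs₁ : charZeroSumTrunc χ x T₁ = S₁ := charZeroSumTrunc_eq hχ x T₁
  have htarget : chebyshevPsiChar₀ χ x -
      (-charZeroSumTrunc χ x T - 1 / 2 * Real.log (x - 1) - χ (-1) / 2 * Real.log (x + 1) +
        explicitFormulaConst χ) =
      (chebyshevPsiChar₀ χ x - W / (2 * π)) + I * (Hb - Ht) / (2 * π) + (S - S₁) := by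
    rw [hzs, hVeq, hR₁, hRc]
    field_simp
    ring
  -- sizes of the three pieces
  set E : ℝ := Real.log x * min 1 (x / (T * primePowDist x)) + x / T * Real.log (q * x * T) ^ 2 with hE
  set Q : ℝ := x / T * Real.log (q * x * T) ^ 2 with hQ
  have hpd := primePowDist_pos x
  have hlogxT : Real.log (q * x * T) = Real.log q + Real.log x + Real.log T := by
    rw [Real.log_mul (by positivity) hT0.ne', Real.log_mul (by positivity) hx0.ne']
  have hlogT : Real.log 2 ≤ Real.log T := Real.log_le_log two_pos hT
  have hlogT0 : 0 < Real.log T := by linarith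
  have hLqxT : Real.log x ≤ Real.log (q * x * T) := by rw [hlogxT]; linarith
  have hlogqxT1 : 1 ≤ Real.log (q * x * T) := by rw [hlogxT]; linarith
  have hmin0 : 0 ≤ min 1 (x / (T * primePowDist x)) := le_min zero_le_one (by positivity)
  have hQ0 : 0 ≤ Q := by positivity
  have hQE : Q ≤ E := by rw [hE, hQ]; linarith [mul_nonneg hL0.le hmin0]
  have hE0 : 0 ≤ E := hQ0.trans hQE
  have hxT : x / T₁ ≤ x / T := div_le_div_of_nonneg_left hx0.le hT0 hT₁
  have hxT0 : 0 ≤ x / T := by positivity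
  -- (1) Perron
  have h1 : ‖chebyshevPsiChar₀ χ x - W / (2 * π)‖ ≤ C₁ * E := by
    have hπ : (0 : ℝ) < 2 * π := by positivity
    have e1 : chebyshevPsiChar₀ χ x - W / (2 * π) = -(W - 2 * π * chebyshevPsiChar₀ χ x) / (2 * π) := by
      field_simp
      ring
    rw [e1, norm_div, norm_neg, hnorm2π, div_le_iff₀ hπ]
    refine hP'.trans ?_
    have hEA : Real.log x * min 1 (x / (T₁ * primePowDist x)) + x / T₁ * Real.log x ^ 2 ≤ E := by
      rw [hE]
      refine add_le_add ?_ ?_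
      · refine mul_le_mul_of_nonneg_left (min_le_min_left _ ?_) hL0.le
        exact div_le_div_of_nonneg_left hx0.le (by positivity) (mul_le_mul_of_nonneg_right hT₁ hpd.le)
      · exact mul_le_mul hxT (pow_le_pow_left₀ hL0.le hLqxT 2) (by positivity) hxT0
    calc C₁ * (Real.log x * min 1 (x / (T₁ * primePowDist x)) + x / T₁ * Real.log x ^ 2) ≤ C₁ * E :=
          mul_le_mul_of_nonneg_left hEA hC₁0.le
      _ ≤ C₁ * E * (2 * π) := by
          have : (1 : ℝ) ≤ 2 * π := by linarith [Real.pi_gt_three]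
          have h0 : 0 ≤ C₁ * E := by positivity
          exact le_mul_of_one_le_right h0 this
  -- (2) the horizontal integrals
  have hℒ3 : ℒ ≤ 3 * Real.log (q * x * T) := by
    have h4 : Real.log (T₁ + 4) ≤ Real.log (4 * T) := Real.log_le_log (by linarith) (by linarith)
    have h44 : Real.log (4 * T) = Real.log 4 + Real.log T := Real.log_mul (by norm_num) hT0.ne'
    have hl4 : Real.log 4 = 2 * Real.log 2 := by
      rw [show (4 : ℝ) = 2 ^ 2 by norm_num, Real.log_pow]; norm_num
    rw [hℒ, habsT, hlogxT]; linarith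
  have hℒQ : ℒ ^ 2 * (x / T₁) ≤ 9 * Q := by
    have : ℒ ^ 2 ≤ 9 * Real.log (q * x * T) ^ 2 := by
      calc ℒ ^ 2 ≤ (3 * Real.log (q * x * T)) ^ 2 := pow_le_pow_left₀ hℒ0.le hℒ3 2
        _ = 9 * Real.log (q * x * T) ^ 2 := by ring
    rw [hQ]
    calc ℒ ^ 2 * (x / T₁) ≤ (9 * Real.log (q * x * T) ^ 2) * (x / T) :=
          mul_le_mul this hxT (by positivity) (by positivity)
      _ = 9 * (x / T * Real.log (q * x * T) ^ 2) := by ring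
  have hH : ∀ H : ℂ, ‖H‖ ≤ Real.exp 1 * x * (Λ₀ / Real.log x + 20 / (Real.exp 1 * Real.log x ^ 2)) / T₁ →
      ‖H‖ ≤ 9 * A₁ * Q := by
    intro H hH
    refine hH.trans ?_
    have hlam2 : lam ^ 2 ≤ Real.log x ^ 2 := pow_le_pow_left₀ hlam0.le hLlam 2
    have h1 : Λ₀ / Real.log x ≤ A₀ * ℒ ^ 2 / lam :=
      div_le_div₀ (by positivity) hΛ₀A hlam0 hLlam
    have hℒ21 : (1 : ℝ) ≤ ℒ ^ 2 := by nlinarith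
    have h2 : 20 / (Real.exp 1 * Real.log x ^ 2) ≤ 20 / (Real.exp 1 * lam ^ 2) * ℒ ^ 2 := by
      calc 20 / (Real.exp 1 * Real.log x ^ 2) ≤ 20 / (Real.exp 1 * lam ^ 2) :=
            div_le_div_of_nonneg_left (by norm_num) (by positivity)
              (mul_le_mul_of_nonneg_left hlam2 (Real.exp_pos 1).le)
        _ ≤ 20 / (Real.exp 1 * lam ^ 2) * ℒ ^ 2 := le_mul_of_one_le_right (by positivity) hℒ21
    calc Real.exp 1 * x * (Λ₀ / Real.log x + 20 / (Real.exp 1 * Real.log x ^ 2)) / T₁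
        ≤ Real.exp 1 * x * (A₀ * ℒ ^ 2 / lam + 20 / (Real.exp 1 * lam ^ 2) * ℒ ^ 2) / T₁ := by
          gcongr
      _ = A₁ * (ℒ ^ 2 * (x / T₁)) := by rw [hA₁]; field_simp
      _ ≤ A₁ * (9 * Q) := mul_le_mul_of_nonneg_left hℒQ hA₁0
      _ = 9 * A₁ * Q := by ring
  have h2 : ‖I * (Hb - Ht) / (2 * π)‖ ≤ 3 * A₁ * Q := by
    have hπ : (0 : ℝ) < 2 * π := by positivity
    rw [norm_div, norm_mul, Complex.norm_I, one_mul, hnorm2π, div_le_iff₀ hπ]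
    have hb' := hH Hb hHbot
    have ht' := hH Ht hHtop
    calc ‖Hb - Ht‖ ≤ ‖Hb‖ + ‖Ht‖ := norm_sub_le _ _
      _ ≤ 9 * A₁ * Q + 9 * A₁ * Q := add_le_add hb' ht'
      _ ≤ 3 * A₁ * Q * (2 * π) := by
          have h0 : 0 ≤ A₁ * Q := by positivity
          have h18 : (18 : ℝ) ≤ 3 * (2 * π) := by linarith [Real.pi_gt_three]
          calc 9 * A₁ * Q + 9 * A₁ * Q = 18 * (A₁ * Q) := by ring
            _ ≤ 3 * (2 * π) * (A₁ * Q) := mul_le_mul_of_nonneg_right h18 h0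
            _ = 3 * A₁ * Q * (2 * π) := by ring
  -- (3) the zeros between `T` and `T₁`
  have h3 : ‖S - S₁‖ ≤ 12 * Cw * Q := by
    rw [norm_sub_rev]
    rw [hzs, hzs₁] at hS
    refine hS.trans ?_
    have hlog92 : Real.log q + Real.log (T + 9 / 2) ≤ 3 * Real.log (q * x * T) := by
      have h4 : Real.log (T + 9 / 2) ≤ Real.log (4 * T) := Real.log_le_log (by linarith) (by linarith)
      rw [Real.log_mul (by norm_num) hT0.ne', show (4 : ℝ) = 2 * 2 by norm_num,
        Real.log_mul two_ne_zero two_ne_zero] at h4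
      rw [hlogxT]
      linarith
    have hlsq : Real.log (q * x * T) ≤ Real.log (q * x * T) ^ 2 := by nlinarith
    calc x / T * D ≤ x / T * (4 * Cw * (Real.log q + Real.log (T + 9 / 2))) :=
          mul_le_mul_of_nonneg_left hD hxT0
      _ ≤ x / T * (4 * Cw * (3 * Real.log (q * x * T) ^ 2)) := by
          refine mul_le_mul_of_nonneg_left ?_ hxT0
          refine mul_le_mul_of_nonneg_left (hlog92.trans (by linarith)) (by positivity)
      _ = 12 * Cw * Q := by rw [hQ]; ring
  -- conclusion
  rw [htarget]
  calc ‖(chebyshevPsiChar₀ χ x - W / (2 * π)) + I * (Hb - Ht) / (2 * π) + (S - S₁)‖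
      ≤ ‖chebyshevPsiChar₀ χ x - W / (2 * π)‖ + ‖I * (Hb - Ht) / (2 * π)‖ + ‖S - S₁‖ := norm_add₃_le
    _ ≤ C₁ * E + 3 * A₁ * Q + 12 * Cw * Q := by gcongr
    _ ≤ (C₁ + 27 * A₁ + 12 * Cw) * E := by
        have p1 : 0 ≤ Cw * (E - Q) := mul_nonneg hCw0.le (by linarith)
        have p2 : 0 ≤ A₁ * (E - Q) := mul_nonneg hA₁0 (by linarith)
        have p3 : 0 ≤ A₁ * E := mul_nonneg hA₁0 hE0
        linarith

end Literature.NumberTheory.LFunctions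

end
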